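import Literature.Probability.LatticeModels.SixVertexGFF
import HarnessLib

/-!
# GFF convergence of the six-vertex height function (DKLM 2026, Thm. 2.8): decomposition along the
# four printed steps of Part II

Topic `Literature/Probability/LatticeModels`. SPLIT of the named fact
`Literature.Probability.LatticeModels.SixVertex.DKLM2026_sixVertex_heightFunction_GFF`
(`SixVertexGFF.lean`; H. Duminil-Copin, K. K. Kozlowski, P. Lammers, I. Manolescu, *Gaussian free
field convergence of the six-vertex model with `-1 ≤ Δ ≤ -1/2`*, arXiv:2603.06268 (2026), Thm. 2.8
in modes (1)–(2) of Def. 2.7) into the four steps of its printed proof (§1.4.1 "Overview of the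
proof structure"; Part II §4 "Proof of the main result": "Theorems 27, 48 and 52 jointly imply that
… one of the following two statements holds true: [a GFF limit `σ·GFF`] / [two distinct
sub-sequential limits `σ·GFF`, `σ'·GFF`]. Yet, we may rule out the second case, since … the
combination of Theorems 14 and 15 yields that both `σ²` and `(σ')²` should be equal to
`1/arcsin(c/2)`"):

* `DKLM2026_twoPoint_dichotomy` — Part II, Theorem 27 (dichotomy for the two-point function);
* `DKLM2026_twoPoint_to_kPoint` — Part II, Theorem 48 (`k = 2` implies all `k`, along a sequence);
* `DKLM2026_convergenceCriterion` — Part II, Theorem 52 (convergence criterion: all `k`-point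
  functions along a sequence ⇒ GFF convergence along it), in the vendored mode (2);
* `DKLM2026_gffAmplitude` — Theorems 14 (GFF–LDP correspondence, `σ² = −1/f''(0)`) and 15
  (`f''(0) = −arcsin(c/2)`), through Theorem 52: a sub-sequential limit all of whose correlation
  functions are those of `σ·GFF` has `σ² = 1/arcsin(c/2)`;

and the PROVED assembly `DKLM2026_sixVertex_heightFunction_GFF_holds_of` — the printed Part II §4
argument (sequential characterisation of `𝓝[>] 0`-limits: Mathlib's
`tendstoUniformlyOn_iff_seq_tendstoUniformlyOn`, `Filter.tendsto_iff_seq_tendsto`).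

All children are stated, like the parent, for `a = b = 1`, `√3 ≤ c ≤ 2` and every planar
slope-zero measure `P` (`IsPlanarSixVertexMeasure 1 1 c P`), over the vocabulary of
`SixVertexGFF.lean` (`kPointScaled = Φ_k^{(δ)}`, `gffKPoint = Ψ_k^{GFF}`, `pairDomain = 𝒟_k`,
`testPairing`, `dirichletEnergy`). In-tree progress below them (≈ 60 `SixVertex*.lean` files):
the transfer matrix and the spectral representation of Part III (`SixVertexTransferMatrix*`,
`SixVertexSpectral*`), the space `𝓜` of Def. 29 and its compactness
(`SixVertexSpectralMeasureSpace/Compactness/Convergence`), the identification step of Theorem 53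
(`SixVertexPlanarGFFLimit*`, `SixVertexGFFSpectralIdentification`), the odd-`k` vanishing
(`SixVertexGFFProofs`), moment formulas for the test pairing (`SixVertexTestPairingMoment*`).

## References

* H. Duminil-Copin, K. K. Kozlowski, P. Lammers, I. Manolescu, arXiv:2603.06268 (2026): §1.4.1
  (overview), Thm. 14, Thm. 15, Part II Thm. 27, Thm. 48, Thm. 52, §4 (proof of Thm. 2.8),
  Def. 2.7. [DKLM2026SixVertexGFF]
-/

noncomputable section

open MeasureTheory Filter Topology ProbabilityTheory
open scoped NNReal BoundedContinuousFunction

namespace Literature.Probability.LatticeModels.SixVertex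

/-! ## The children (named facts) -/

/-- NAMED FACT (DKLM 2026, Part II, Theorem 27 — dichotomy for the two-point function). For
`a = b = 1`, `√3 ≤ c ≤ 2` and every planar slope-zero six-vertex measure `P`, one of the following
holds: (i) there is `σ ≥ 0` such that `Φ₂^{(δ)} → σ² Ψ₂^{GFF}` uniformly on every compact subset of
`𝒟₂` as `δ → 0⁺`; (ii) there are two distinct `σ, σ' ≥ 0` and two sequences `δ_n, δ'_n → 0⁺` such
that `Φ₂^{(δ_n)} → σ² Ψ₂^{GFF}` and `Φ₂^{(δ'_n)} → σ'² Ψ₂^{GFF}` uniformly on compact subsets of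
`𝒟₂`. Print: "One of the following two properties holds true: • There exists some `σ ∈ ℝ_{≥0}`
such that `Φ₂^{(δ)}` converges to `σ²Ψ₂^{GFF}` uniformly on every compact subset of `𝒟₂` as `δ`
tends to zero, • There exist two distinct `σ, σ' ∈ ℝ_{≥0}` and two sequences `(δ_n)_n, (δ'_n)_n`
tending to zero such that `Φ₂^{(δ_n)}` and `Φ₂^{(δ'_n)}` converge to `σ²Ψ₂^{GFF}` and
`(σ')²Ψ₂^{GFF}` respectively, uniformly on every compact subset of `𝒟₂`" (proved in Part II §1 from
the spectral representation of Part III, rotational invariance and the regularity estimates of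
Part IV). Users take `(h : DKLM2026_twoPoint_dichotomy)`.
[cite: DKLM2026SixVertexGFF, Part II Thm. 27 (dichotomy for the two-point function)] -/
def DKLM2026_twoPoint_dichotomy : Prop :=
  ∀ (c : ℝ), Real.sqrt 3 ≤ c → c ≤ 2 →
    ∀ (P : Measure (Config (ℤ × ℤ))), IsPlanarSixVertexMeasure 1 1 c P →
      (∃ σ : ℝ, 0 ≤ σ ∧ ∀ K ⊆ pairDomain 2, IsCompact K →
          TendstoUniformlyOn (fun δ u => kPointScaled P 2 δ u)
            (fun u => σ ^ 2 * gffKPoint 2 u) (𝓝[>] (0 : ℝ)) K) ∨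
      (∃ σ σ' : ℝ, 0 ≤ σ ∧ 0 ≤ σ' ∧ σ ≠ σ' ∧ ∃ δs δs' : ℕ → ℝ,
          Tendsto δs atTop (𝓝[>] (0 : ℝ)) ∧ Tendsto δs' atTop (𝓝[>] (0 : ℝ)) ∧
          (∀ K ⊆ pairDomain 2, IsCompact K →
            TendstoUniformlyOn (fun n u => kPointScaled P 2 (δs n) u)
              (fun u => σ ^ 2 * gffKPoint 2 u) atTop K) ∧
          (∀ K ⊆ pairDomain 2, IsCompact K →
            TendstoUniformlyOn (fun n u => kPointScaled P 2 (δs' n) u)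
              (fun u => σ' ^ 2 * gffKPoint 2 u) atTop K))

/-- NAMED FACT (DKLM 2026, Part II, Theorem 48 — from two-point to multi-point functions). For
`a = b = 1`, `√3 ≤ c ≤ 2`, every planar slope-zero measure `P`, every `σ ≥ 0` and every sequence
`δ_n → 0⁺`: if `Φ₂^{(δ_n)} → σ² Ψ₂^{GFF}` uniformly on compact subsets of `𝒟₂`, then for every
`k ≥ 1`, `Φ_k^{(δ_n)} → σ^k Ψ_k^{GFF}` uniformly on compact subsets of `𝒟_k`. Print: "Fix
`σ ∈ ℝ_{≥0}` and a sequence `(δ_n)_n` tending to zero. Consider the following statement for fixed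
`k`: `Φ_k^{(δ_n)}|_{𝒟_k} → σ^k Ψ_k^{GFF}` uniformly on compact subsets of `𝒟_k`. If this statement
holds true for `k = 2`, then it holds true for all `k ∈ ℤ_{≥1}`" (harmonicity of sub-sequential
limits, Prop. 49, from the concentration of the spectral measure on `{b = ±a}`, and an inductive
identification). Users take `(h : DKLM2026_twoPoint_to_kPoint)`.
[cite: DKLM2026SixVertexGFF, Part II Thm. 48 (sub-sequential GFF limits for multi-point functions)] -/
def DKLM2026_twoPoint_to_kPoint : Prop :=
  ∀ (c : ℝ), Real.sqrt 3 ≤ c → c ≤ 2 →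
    ∀ (P : Measure (Config (ℤ × ℤ))), IsPlanarSixVertexMeasure 1 1 c P →
      ∀ (σ : ℝ), 0 ≤ σ → ∀ (δs : ℕ → ℝ), Tendsto δs atTop (𝓝[>] (0 : ℝ)) →
        (∀ K ⊆ pairDomain 2, IsCompact K →
          TendstoUniformlyOn (fun n u => kPointScaled P 2 (δs n) u)
            (fun u => σ ^ 2 * gffKPoint 2 u) atTop K) →
        ∀ (k : ℕ), 1 ≤ k → ∀ K ⊆ pairDomain k, IsCompact K →
          TendstoUniformlyOn (fun n u => kPointScaled P k (δs n) u)
            (fun u => σ ^ k * gffKPoint k u) atTop K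

/-- NAMED FACT (DKLM 2026, Part II, Theorem 52 — convergence criterion, mode (2)). For `a = b = 1`,
`√3 ≤ c ≤ 2`, every planar slope-zero measure `P`, every `σ ≥ 0` and every sequence `δ_n → 0⁺`: if
for all `k ≥ 1`, `Φ_k^{(δ_n)} → σ^k Ψ_k^{GFF}` uniformly on compact subsets of `𝒟_k`, then for every
continuous compactly supported `ρ : ℂ → ℝ` with `∫ ρ = 0` the law of `⟨h^{(δ_n)}, ρ⟩` converges
weakly to the centred Gaussian of variance `σ² ∬ G ρ ⊗ ρ` (tested against bounded continuous `g`).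
Print: "Fix `σ ∈ ℝ_{≥0}` and let `(δ_n)_n` denote a sequence tending to zero. If for all `k ∈ ℤ_{≥1}`,
`Φ_k^{(δ_n)}|_{𝒟_k} → σ^k Ψ_k^{GFF}` uniformly on compacts of `𝒟_k`, then the height function
converges to `σ·GFF` along the scaling sequence `(δ_n)_n` in the sense of Definition 2.7" ("The
proof relies on a single input: the regularity estimate of Theorem 12"; moments and a dominating
function). Only mode (2) of Def. 2.7, in the vendored sub-class of test functions, is recorded, as
in the parent. Users take `(h : DKLM2026_convergenceCriterion)`.
[cite: DKLM2026SixVertexGFF, Part II Thm. 52 (convergence criterion) with Def. 2.7 (2)] -/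
def DKLM2026_convergenceCriterion : Prop :=
  ∀ (c : ℝ), Real.sqrt 3 ≤ c → c ≤ 2 →
    ∀ (P : Measure (Config (ℤ × ℤ))), IsPlanarSixVertexMeasure 1 1 c P →
      ∀ (σ : ℝ), 0 ≤ σ → ∀ (δs : ℕ → ℝ), Tendsto δs atTop (𝓝[>] (0 : ℝ)) →
        (∀ (k : ℕ), 1 ≤ k → ∀ K ⊆ pairDomain k, IsCompact K →
          TendstoUniformlyOn (fun n u => kPointScaled P k (δs n) u)
            (fun u => σ ^ k * gffKPoint k u) atTop K) →
        ∀ (ρ : ℂ → ℝ), Continuous ρ → HasCompactSupport ρ → ∫ z, ρ z = 0 →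
          ∀ g : ℝ →ᵇ ℝ,
            Tendsto (fun n => ∫ ω, g (testPairing ω (δs n) ρ) ∂P) atTop
              (𝓝 (∫ x, g x ∂(gaussianReal 0 (Real.toNNReal (σ ^ 2 * dirichletEnergy ρ)))))

/-- NAMED FACT (DKLM 2026, Theorems 14 and 15 with Theorem 52 — the amplitude of a sub-sequential
GFF limit). For `a = b = 1`, `√3 ≤ c ≤ 2`, every planar slope-zero measure `P`, every `σ ≥ 0` and
every sequence `δ_n → 0⁺` along which all correlation functions converge to those of `σ·GFF`
(`Φ_k^{(δ_n)} → σ^k Ψ_k^{GFF}` uniformly on compacts of `𝒟_k`, all `k ≥ 1`): `σ² = 1/arcsin(c/2)`.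
Print (§1.4.1 and Part II §4): "Theorems 14 and 15 jointly imply that if for some `(δ_n)_n`,
`h^{(δ_n)}` converges to `σ·GFF`, then `σ² = 2/arccos Δ`"; Theorem 14 (GFF–LDP correspondence):
"Assume that the six-vertex model has a sub-sequential scaling limit of the form `σ·GFF`. Then
`σ² = −1/f''(0)`" (`f` the free energy, Def. 13; proved in Part VI from the variational principle,
the arm-exponent bounds and flip domination); Theorem 15: "`f''(0) = −½ arccos Δ = −arcsin(c/2)`"
(Bethe Ansatz, after Duminil-Copin–Kozlowski–Krachun 2022). The hypothesis "converges to `σ·GFF`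
along `(δ_n)`" (all modes of Def. 2.7) is supplied from the correlation functions by Theorem 52, so
the statement recorded here is implied by Theorems 14, 15, 52 together. Users take
`(h : DKLM2026_gffAmplitude)`.
[cite: DKLM2026SixVertexGFF, Thm. 14 (GFF-LDP correspondence), Thm. 15 (computation of f''(0)), Part II Thm. 52 and §4] -/
def DKLM2026_gffAmplitude : Prop :=
  ∀ (c : ℝ), Real.sqrt 3 ≤ c → c ≤ 2 →
    ∀ (P : Measure (Config (ℤ × ℤ))), IsPlanarSixVertexMeasure 1 1 c P →
      ∀ (σ : ℝ), 0 ≤ σ → ∀ (δs : ℕ → ℝ), Tendsto δs atTop (𝓝[>] (0 : ℝ)) →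
        (∀ (k : ℕ), 1 ≤ k → ∀ K ⊆ pairDomain k, IsCompact K →
          TendstoUniformlyOn (fun n u => kPointScaled P k (δs n) u)
            (fun u => σ ^ k * gffKPoint k u) atTop K) →
        σ ^ 2 = 1 / Real.arcsin (c / 2)

/-! ## The assembly (proved) -/

/-- `1/(n+1) → 0⁺`: a scaling sequence. [folklore] -/
theorem tendsto_one_div_succ_nhdsWithin :
    Tendsto (fun n : ℕ => 1 / ((n : ℝ) + 1)) atTop (𝓝[>] (0 : ℝ)) := by
  refine tendsto_nhdsWithin_iff.2 ⟨tendsto_one_div_add_atTop_nhds_zero_nat, ?_⟩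
  exact Eventually.of_forall fun n => Set.mem_Ioi.2 (by positivity)

/-- The amplitude of a limit is `σ(c)`: `σ ≥ 0` and `σ² = 1/arcsin(c/2)` give `σ = dklmSigma c`.
[folklore] -/
theorem eq_dklmSigma_of_sq_eq {c σ : ℝ} (hσ : 0 ≤ σ) (h : σ ^ 2 = 1 / Real.arcsin (c / 2)) :
    σ = dklmSigma c := by
  rw [dklmSigma, ← h, Real.sqrt_sq hσ]

/-- **DKLM Theorem 2.8 from the four steps of Part II (SPLIT assembly).** Theorem 27 (dichotomy),
Theorem 48 (`k = 2 ⇒` all `k`), Theorem 52 (criterion) and Theorems 14–15 (amplitude) imply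
`DKLM2026_sixVertex_heightFunction_GFF`, exactly as in Part II §4 of the source: along every scaling
sequence the two-point function converges (in the first case of the dichotomy by restriction, the
second case being excluded because both amplitudes equal `1/arcsin(c/2)`), hence all correlation
functions converge (Thm. 48) with amplitude `σ(c)` (Thms. 14–15), hence mode (2) holds along the
sequence (Thm. 52); limits along `𝓝[>] 0` are sequential.
[cite: DKLM2026SixVertexGFF, Part II §4 (proof of Thm. 2.8)] -/
theorem DKLM2026_sixVertex_heightFunction_GFF_holds_of (h₁ : DKLM2026_twoPoint_dichotomy)
    (h₂ : DKLM2026_twoPoint_to_kPoint) (h₃ : DKLM2026_convergenceCriterion)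
    (h₄ : DKLM2026_gffAmplitude) : DKLM2026_sixVertex_heightFunction_GFF := by
  intro c hc₁ hc₂ P hP
  -- Step 1: the two-point function converges along `𝓝[>] 0` with SOME amplitude `σ ≥ 0`.
  have h2pt : ∃ σ : ℝ, 0 ≤ σ ∧ ∀ K ⊆ pairDomain 2, IsCompact K →
      TendstoUniformlyOn (fun δ u => kPointScaled P 2 δ u)
        (fun u => σ ^ 2 * gffKPoint 2 u) (𝓝[>] (0 : ℝ)) K := by
    rcases h₁ c hc₁ hc₂ P hP with h | ⟨σ, σ', hσ, hσ', hne, δs, δs', hδs, hδs', hK, hK'⟩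
    · exact h
    · -- the second case of the dichotomy is excluded by the amplitude theorem
      exfalso
      have e₁ := h₄ c hc₁ hc₂ P hP σ hσ δs hδs (h₂ c hc₁ hc₂ P hP σ hσ δs hδs hK)
      have e₂ := h₄ c hc₁ hc₂ P hP σ' hσ' δs' hδs' (h₂ c hc₁ hc₂ P hP σ' hσ' δs' hδs' hK')
      exact hne ((eq_dklmSigma_of_sq_eq hσ e₁).trans (eq_dklmSigma_of_sq_eq hσ' e₂).symm)
  obtain ⟨σ, hσ, hK⟩ := h2pt
  -- Step 2: along every scaling sequence, all `k`-point functions converge with amplitude `σ`.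
  have hall : ∀ δs : ℕ → ℝ, Tendsto δs atTop (𝓝[>] (0 : ℝ)) →
      ∀ (k : ℕ), 1 ≤ k → ∀ K ⊆ pairDomain k, IsCompact K →
        TendstoUniformlyOn (fun n u => kPointScaled P k (δs n) u)
          (fun u => σ ^ k * gffKPoint k u) atTop K := fun δs hδs =>
    h₂ c hc₁ hc₂ P hP σ hσ δs hδs fun K hKD hKc =>
      (hK K hKD hKc).seq_tendstoUniformlyOn δs hδs
  -- Step 3: the amplitude is `σ(c)`.
  have hσc : σ = dklmSigma c :=
    eq_dklmSigma_of_sq_eq hσ (h₄ c hc₁ hc₂ P hP σ hσ _ tendsto_one_div_succ_nhdsWithin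
      (hall _ tendsto_one_div_succ_nhdsWithin))
  subst hσc
  refine ⟨fun k hk K hKD hKc => ?_, fun ρ hρ hsupp hint g => ?_⟩
  · -- mode (1): sequential characterisation of uniform convergence along `𝓝[>] 0`
    exact tendstoUniformlyOn_of_seq_tendstoUniformlyOn fun δs hδs => hall δs hδs k hk K hKD hKc
  · -- mode (2): Theorem 52 along every sequence, then the sequential characterisation
    exact tendsto_of_seq_tendsto fun δs hδs =>
      h₃ c hc₁ hc₂ P hP _ hσ δs hδs (hall δs hδs) ρ hρ hsupp hint g

end Literature.Probability.LatticeModels.SixVertex
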